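import Literature.NumberTheory.Automorphic.GLnCuspidalSpectrum
import Literature.NumberTheory.GaloisRepresentations.HeckeCharacter
import Mathlib.MeasureTheory.Function.Holder
import HarnessLib

/-!
# Twisting automorphic representations by characters: `π ⊗ χ`

Fifth layer of the decomposition of the named fact
`Literature.NumberTheory.Automorphic.exists_cuspidal_baseChange_of_not_dvd` (**lang.S23**, `Literature/…/Sweep1.lean`;
Arthur–Clozel, *Simple algebras, base change, and the advanced theory of the trace formula*,
Ann. of Math. Stud. 120 (1989), Ch. 3, Thm. 4.2). The printed statements of Ch. 3 that the
earlier layers (`Sweep1Proofs`, `PairLFunctionBaseChange`, `UnramifiedHeckeScalars`,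
`UnramifiedHeckeLevel`) could not express all involve **twists** of a cuspidal automorphic
representation `π` of `GL_n(𝔸_F)` by a character `χ` of `F^* \ 𝔸_F^*`: Thm. 3.1 (p. 172:
"`(t_{π,v})^{f_v} = (t_{π',v})^{f_v}` for almost all `v` ⟹ `π' = π ⊗ χ` for some character `χ` of
`F^* N(𝔸_E^*) \ 𝔸^*`"), and Thm. 4.2 (p. 173), whose cases are cut out by `π ≇ π ⊗ η` (a) versus
`π ≅ π ⊗ η` (b), (e), with (d) "all such `π` are conjugate by tensor product by a power of `η`".
This file constructs the twist **inside the tree's model** of cuspidal automorphic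
representations (`CuspidalAutomorphicRepGL n K μ`: irreducible closed subrepresentations of
`L²_cusp(GL_n(𝔸_K) ⧸ A_G GL_n(K), μ)` under the regular representation `rightRegular`), with
complete proofs and no new named fact:

* `AdelicGroupData.AutomorphicCharacter 𝒢` (**definition**): a continuous unitary character
  `ψ : G(𝔸_K) → ℂˣ` trivial on `A_G · G(K)`; it descends to a continuous function `ψ̄` of absolute
  value `1` on the automorphic quotient (`quotientFun`, `quotientFun_smul`:
  `ψ̄(g x) = ψ(g) ψ̄(x)`). For `GL_n`: `detChar χ = χ ∘ det` for a unitary Hecke character `χ`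
  of `K` (`Literature.NumberTheory.GaloisRepresentations.HeckeCharacter`, a continuous character of `𝔸_Kˣ / Kˣ`) trivial on the positive
  reals `ℝ_{>0} ↪ 𝔸_Kˣ` — triviality on `GL_n(K)` (`det γ ∈ Kˣ`) and on `A_G`
  (`det (t · 1) = t^n`, `GLn.det_posRealScalar`) are **proved**, as is the triviality of every
  finite-order `χ` on `ℝ_{>0}` (`HeckeCharacter.map_posRealIdele_of_isFiniteOrder`), which covers
  Arthur–Clozel's `η` (of order `l`).
* `AutomorphicCharacter.mulL2 / mulL2Equiv` (**the multiplication operator `M_ψ f = ψ̄ · f`**,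
  a linear isometry equivalence of `L²(μ)` with inverse `M_{ψ⁻¹}`), and the commutation rule
  `rightRegular_mulL2`: `R(g) M_ψ = ψ(g)⁻¹ M_ψ R(g)` (**proved**; recall
  `(R(g) φ)(x) = φ(g⁻¹ x)` on the left coset space `G(𝔸_K) ⧸ A_G G(K)`).
* `ContRepresentation.ClosedSubrep.mapTwisted`, `mapTwistedOrderIso`,
  `isTopIrreducible_iff_of_isTwistedEquivariant` (**generic, proved**): transport of closed
  subrepresentations along a topological isomorphism `e` with `e ∘ π(g) = c(g) π'(g) ∘ e`
  (`IsTwistedEquivariant`, `c : G → kˣ`) is an order isomorphism, so topological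
  irreducibility is preserved.
* `ContRepresentation.ClosedSubrep.twist W ψ = M_ψ(W)` (**the twist of a closed
  subrepresentation of `L²`**), with `twistEquiv : W ≃L M_ψ(W)`, `twist_twist_inv`,
  `twist_one`, `twist_bot`, `twist_le_twist_iff`, and `isTopIrreducible_twist_iff` (**proved**).
  By `rightRegular_mulL2`, `M_ψ(W)` realises the representation `W ⊗ ψ⁻¹`.
* `GL_n` and cuspidality (**proved**): `χ ∘ det` kills the unipotent radicals
  (`GLn.det_glUnipotent`: `det (1 + X) = 1` for block-nilpotent `X`), so multiplication by `ψ̄`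
  preserves vanishing of constant terms (`ConstantTermVanishes.quotientFun_mul`), continuous
  cusp forms (`quotientFun_mul_mem_cuspForms`) and their closure `L²_cusp`
  (`mulL2_mem_cuspidalSubspace`, `twist_le_cuspidalSubspace`).
* `CuspidalAutomorphicRepGL.twist P ψ` and **`CuspidalAutomorphicRepGL.twistByChar P χ = π ⊗ χ`**
  (**definitions**): the latter is `M_{(χ∘det)⁻¹}(π)`, which realises `π ⊗ (χ ∘ det)` in the
  convention above; it is again a cuspidal automorphic representation in the same `L²_cusp`.

The effect on Satake parameters (`t_{π ⊗ χ, v} = χ(ϖ_v) t_{π,v}` at places where `π` and `χ` are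
unramified, Arthur–Clozel p. 172: "`ζ_v = η(ϖ_v)`") is the subject of the sibling file
`AutomorphicTwistSatake`.

## Conventions and design notes

* The automorphic quotient of the tree is the *left* coset space `G(𝔸_K) ⧸ A_G G(K)` with
  `G(𝔸_K)` acting on the left and `(R(g) φ)(x) = φ(g⁻¹ x)` (`AdelicGroupData.rightRegular`); under
  the dictionary `F(h) = φ(h⁻¹)` with classical automorphic forms `F` on `G(K) A_G \ G(𝔸_K)`, the
  classical twist `F · (χ ∘ det)` corresponds to `φ · (χ̄ ∘ det)⁻¹`, whence the inverse in
  `twistByChar`.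
* `AutomorphicCharacter` is a structure (four fields: homomorphism, continuity, unitarity,
  triviality on `A_G · G(K)`), with `FunLike`, `1`, `⁻¹`; no topology or group structure on it is
  needed here. Unitarity makes `M_ψ` an isometry of `L²`; continuity makes `ψ̄ φ` a continuous
  cusp form for `φ` one.
* Hypotheses kept explicit rather than hidden in definitions: `χ.IsUnitary` and
  `∀ t, χ (posRealIdele K t) = 1` for `detChar`/`twistByChar` (both hold for `χ` of finite
  order: `IsFiniteOrder.isUnitary` of `HeckeCharacter`, `map_posRealIdele_of_isFiniteOrder`
  here); `∀ k X, ψ (glUnipotent n k K X) = 1` for the cuspidal twist by a general `ψ`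
  (automatic for `χ ∘ det`, `detChar_glUnipotent`).
* Mathlib provides the `L^∞`-action on `L^p` (`MeasureTheory.Lp` `HSMul` instance of
  `Mathlib.MeasureTheory.Function.Holder`); we use the elementary route `MemLp.of_le_mul` with the
  bound `‖ψ̄ f‖ ≤ ‖f‖` instead, which avoids exponent bookkeeping, and bundle `M_ψ` as a
  `LinearIsometryEquiv` by hand.

## References

* J. Arthur, L. Clozel, *Simple algebras, base change, and the advanced theory of the trace
  formula*, Ann. of Math. Stud. 120 (1989), Ch. 3, Thm. 3.1 (p. 172), Thm. 4.2 (p. 173)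
  [ArthurClozelAMS120].
* A. Borel, H. Jacquet, *Automorphic forms and automorphic representations*, Corvallis (1979),
  Part 1, §4.4–4.6 (cusp forms, constant terms) [BorelJacquetCorvallis1979].
* J. Tate, *Fourier analysis in number fields and Hecke's zeta-functions*, in Cassels–Fröhlich
  (1967), Ch. XV, §4.3 (quasi-characters of the idele class group) [TateThesis1967].
-/

noncomputable section

open scoped MatrixGroups ENNReal
open NumberField IsDedekindDomain MeasureTheory

/-! ### Closed subrepresentations under twisted-equivariant isomorphisms (generic) -/

namespace ContRepresentation.ClosedSubrep

section MapTwisted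

variable {k G V V' : Type*} [CommRing k] [Monoid G]
  [AddCommGroup V] [TopologicalSpace V] [IsTopologicalAddGroup V] [Module k V]
  [AddCommGroup V'] [TopologicalSpace V'] [IsTopologicalAddGroup V'] [Module k V']
  {π : ContRepresentation k G V} {π' : ContRepresentation k G V'}

/-- A topological linear isomorphism `e : V ≃L V'` is **`c`-twisted equivariant** from `π` to
`π'` (`c : G → kˣ`) if `e (π g v) = c g • π' g (e v)`; for `c = 1` this is an equivalence of
representations, in general an equivalence `π ≅ π' ⊗ c`. [folklore] -/
def IsTwistedEquivariant (π : ContRepresentation k G V) (π' : ContRepresentation k G V')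
    (e : V ≃L[k] V') (c : G → kˣ) : Prop :=
  ∀ g v, e (π g v) = (c g : k) • π' g (e v)

variable {e : V ≃L[k] V'} {c : G → kˣ}

/-- The inverse of a `c`-twisted equivariant isomorphism is `c⁻¹`-twisted equivariant. [folklore] -/
theorem IsTwistedEquivariant.symm (he : IsTwistedEquivariant π π' e c) :
    IsTwistedEquivariant π' π e.symm c⁻¹ := by
  intro g v'
  apply e.injective
  rw [e.apply_symm_apply, Pi.inv_apply, map_smul, he, e.apply_symm_apply, smul_smul,
    Units.inv_mul, one_smul]

/-- **Transport of closed subrepresentations along a twisted-equivariant isomorphism**: the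
image `e(W)` of a closed `π`-invariant subspace under `e` with `e ∘ π(g) = c(g) π'(g) ∘ e` is a
closed `π'`-invariant subspace (`π'(g) e(w) = e(c(g)⁻¹ π(g) w)`; `e` is a homeomorphism).
[folklore] -/
def mapTwisted (W : ClosedSubrep π) (he : IsTwistedEquivariant π π' e c) : ClosedSubrep π' where
  toSubmodule := W.toSubmodule.map (e : V →ₗ[k] V')
  apply_mem_toSubmodule g := by
    rintro _ ⟨v, hv, rfl⟩
    refine ⟨((c g)⁻¹ : kˣ) • π g v, W.toSubmodule.smul_mem _ (W.apply_mem g hv), ?_⟩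
    change e (((c g)⁻¹ : kˣ) • π g v) = π' g (e v)
    rw [Units.smul_def, map_smul, he, smul_smul, Units.inv_mul, one_smul]
  isClosed' := by
    change IsClosed ((W.toSubmodule.map (e : V →ₗ[k] V') : Submodule k V') : Set V')
    rw [Submodule.map_coe]
    exact e.isClosed_image.mpr W.isClosed

/-- The submodule underlying `W.mapTwisted he` is the image `e(W)` (definitional). [folklore] -/
@[simp]
theorem toSubmodule_mapTwisted (W : ClosedSubrep π) (he : IsTwistedEquivariant π π' e c) :
    (W.mapTwisted he).toSubmodule = W.toSubmodule.map (e : V →ₗ[k] V') := rfl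

/-- `v' ∈ e(W) ↔ e⁻¹ v' ∈ W`. [folklore] -/
theorem mem_mapTwisted_iff (W : ClosedSubrep π) (he : IsTwistedEquivariant π π' e c) {v' : V'} :
    v' ∈ W.mapTwisted he ↔ e.symm v' ∈ W := by
  change v' ∈ W.toSubmodule.map (e : V →ₗ[k] V') ↔ _
  constructor
  · rintro ⟨v, hv, rfl⟩
    change e.symm (e v) ∈ W
    rwa [e.symm_apply_apply]
  · intro h
    exact ⟨e.symm v', h, e.apply_symm_apply v'⟩

/-- `e w ∈ e(W)` for `w ∈ W`. [folklore] -/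
theorem apply_mem_mapTwisted (W : ClosedSubrep π) (he : IsTwistedEquivariant π π' e c) {v : V}
    (hv : v ∈ W) : e v ∈ W.mapTwisted he :=
  (W.mem_mapTwisted_iff he).mpr (by rwa [e.symm_apply_apply])

/-- `e⁻¹(e(W)) = W`. [folklore] -/
theorem mapTwisted_mapTwisted_symm (W : ClosedSubrep π) (he : IsTwistedEquivariant π π' e c) :
    (W.mapTwisted he).mapTwisted he.symm = W := by
  ext v
  rw [mem_mapTwisted_iff, mem_mapTwisted_iff, e.symm_symm, e.symm_apply_apply]

/-- `e(e⁻¹(W')) = W'`. [folklore] -/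
theorem mapTwisted_symm_mapTwisted (W' : ClosedSubrep π') (he : IsTwistedEquivariant π π' e c) :
    (W'.mapTwisted he.symm).mapTwisted he = W' := by
  ext v
  rw [mem_mapTwisted_iff, mem_mapTwisted_iff, e.symm_symm, e.apply_symm_apply]

/-- `e(W₁) ≤ e(W₂) ↔ W₁ ≤ W₂`. [folklore] -/
theorem mapTwisted_le_mapTwisted_iff {W₁ W₂ : ClosedSubrep π}
    (he : IsTwistedEquivariant π π' e c) :
    W₁.mapTwisted he ≤ W₂.mapTwisted he ↔ W₁ ≤ W₂ := by
  constructor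
  · intro h v hv
    have := h (W₁.apply_mem_mapTwisted he hv)
    rwa [mem_mapTwisted_iff, e.symm_apply_apply] at this
  · intro h v' hv'
    rw [mem_mapTwisted_iff] at hv' ⊢
    exact h hv'

/-- Transport along a twisted-equivariant isomorphism is an **order isomorphism** between the
lattices of closed subrepresentations of `π` and of `π'`. [folklore] -/
def mapTwistedOrderIso (he : IsTwistedEquivariant π π' e c) : ClosedSubrep π ≃o ClosedSubrep π' where
  toFun W := W.mapTwisted he
  invFun W' := W'.mapTwisted he.symm
  left_inv W := W.mapTwisted_mapTwisted_symm he
  right_inv W' := W'.mapTwisted_symm_mapTwisted he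
  map_rel_iff' := mapTwisted_le_mapTwisted_iff he

/-- Unfolding `mapTwistedOrderIso`. [folklore] -/
@[simp]
theorem mapTwistedOrderIso_apply (he : IsTwistedEquivariant π π' e c) (W : ClosedSubrep π) :
    mapTwistedOrderIso he W = W.mapTwisted he := rfl

/-- **Topological irreducibility is invariant under twisted-equivariant isomorphisms**
(`π ≅ π' ⊗ c` with `c` a character: the closed invariant subspaces correspond). [folklore] -/
theorem isTopIrreducible_iff_of_isTwistedEquivariant [T1Space V] [T1Space V']
    (he : IsTwistedEquivariant π π' e c) : π.IsTopIrreducible ↔ π'.IsTopIrreducible :=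
  (mapTwistedOrderIso he).isSimpleOrder_iff

end MapTwisted

end ContRepresentation.ClosedSubrep

namespace Literature.NumberTheory.Automorphic

namespace AdelicGroupData

universe u

variable {K : Type} [Field K] [NumberField K]

/-- A **unitary automorphic character** of the adelic group `G(𝔸_K)`: a continuous unitary
character `ψ : G(𝔸_K) → ℂˣ` trivial on `A_G · G(K)`, i.e. a continuous function on the
automorphic quotient `G(𝔸_K) ⧸ A_G G(K)` of absolute value `1` which is multiplicative. For
`G = GL_n` these are the `χ ∘ det` with `χ` a unitary character of `𝔸_Kˣ / Kˣ` trivial on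
`ℝ_{>0}` (Arthur–Clozel (1989), Ch. 3, §1: twists `π ⊗ χ`; Borel–Jacquet (1979), §4).
[folklore] -/
structure AutomorphicCharacter (𝒢 : AdelicGroupData.{u} K) where
  /-- The underlying homomorphism `G(𝔸_K) →* ℂˣ`. -/
  toMonoidHom : 𝒢.Adelic →* ℂˣ
  /-- Continuity of `g ↦ ψ g ∈ ℂ`. -/
  continuous_coe : Continuous fun g => (toMonoidHom g : ℂ)
  /-- Unitarity `‖ψ g‖ = 1`. -/
  norm_apply : ∀ g, ‖(toMonoidHom g : ℂ)‖ = 1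
  /-- Triviality on `A_G · G(K)`. -/
  map_eq_one_of_mem : ∀ g ∈ 𝒢.quotientSubgroup, toMonoidHom g = 1

namespace AutomorphicCharacter

variable {𝒢 : AdelicGroupData.{u} K} (ψ : 𝒢.AutomorphicCharacter)

/-- Automorphic characters as functions `G(𝔸_K) → ℂˣ`. [folklore] -/
instance instFunLike : FunLike 𝒢.AutomorphicCharacter 𝒢.Adelic ℂˣ where
  coe ψ := ψ.toMonoidHom
  coe_injective ψ ψ' h := by
    cases ψ; cases ψ'; congr; exact DFunLike.coe_injective h

/-- Automorphic characters are homomorphisms. [folklore] -/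
instance instMonoidHomClass : MonoidHomClass 𝒢.AutomorphicCharacter 𝒢.Adelic ℂˣ where
  map_mul ψ := map_mul ψ.toMonoidHom
  map_one ψ := map_one ψ.toMonoidHom

/-- The coercion to functions is `toMonoidHom`. [folklore] -/
@[simp] theorem coe_toMonoidHom : (ψ.toMonoidHom : 𝒢.Adelic → ℂˣ) = ψ := rfl

/-- `g ↦ ψ g ∈ ℂ` is continuous. [folklore] -/
theorem continuous : Continuous fun g => ((ψ g : ℂˣ) : ℂ) := ψ.continuous_coe

/-- `‖ψ g‖ = 1`. [folklore] -/
theorem norm_coe (g : 𝒢.Adelic) : ‖((ψ g : ℂˣ) : ℂ)‖ = 1 := ψ.norm_apply g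

/-- `ψ = 1` on `A_G · G(K)`. [folklore] -/
theorem map_of_mem {g : 𝒢.Adelic} (hg : g ∈ 𝒢.quotientSubgroup) : ψ g = 1 :=
  ψ.map_eq_one_of_mem g hg

/-- The trivial automorphic character. [folklore] -/
instance instOne : One 𝒢.AutomorphicCharacter :=
  ⟨{ toMonoidHom := 1
     continuous_coe := continuous_const
     norm_apply := fun _ => by simp
     map_eq_one_of_mem := fun _ _ => rfl }⟩

/-- The trivial character takes the value `1`. [folklore] -/
@[simp] theorem one_apply (g : 𝒢.Adelic) : (1 : 𝒢.AutomorphicCharacter) g = 1 := rfl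

/-- Automorphic characters are inhabited (by the trivial character). [folklore] -/
instance instInhabited : Inhabited 𝒢.AutomorphicCharacter := ⟨1⟩

/-- Pointwise inverse (complex conjugate) character. [folklore] -/
instance instInv : Inv 𝒢.AutomorphicCharacter :=
  ⟨fun ψ =>
    { toMonoidHom := ψ.toMonoidHom⁻¹
      continuous_coe := by
        have : (fun g => ((ψ.toMonoidHom⁻¹ g : ℂˣ) : ℂ)) = fun g => ((ψ g : ℂˣ) : ℂ)⁻¹ := by
          funext g
          exact Units.val_inv_eq_inv_val _
        rw [this]
        exact ψ.continuous.inv₀ fun g h => by simpa [h] using ψ.norm_coe g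
      norm_apply := fun g => by
        change ‖(((ψ g)⁻¹ : ℂˣ) : ℂ)‖ = 1
        rw [Units.val_inv_eq_inv_val, norm_inv, ψ.norm_coe, _root_.inv_one]
      map_eq_one_of_mem := fun g hg => by
        change (ψ g)⁻¹ = 1
        rw [ψ.map_of_mem hg, _root_.inv_one] }⟩

/-- `ψ⁻¹ g = (ψ g)⁻¹`. [folklore] -/
@[simp] theorem inv_apply (g : 𝒢.Adelic) : ψ⁻¹ g = (ψ g)⁻¹ := rfl

/-- `ψ⁻¹ g = (ψ g)⁻¹` in `ℂ`. [folklore] -/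
theorem coe_inv_apply (g : 𝒢.Adelic) : ((ψ⁻¹ g : ℂˣ) : ℂ) = ((ψ g : ℂˣ) : ℂ)⁻¹ :=
  Units.val_inv_eq_inv_val _

/-- `(ψ⁻¹)⁻¹ = ψ`. [folklore] -/
theorem inv_inv : ψ⁻¹⁻¹ = ψ := DFunLike.ext _ _ fun g => by simp

/-- The character as a function on the automorphic quotient `G(𝔸_K) ⧸ A_G G(K)`. [folklore] -/
def quotientFun : 𝒢.automorphicQuotient → ℂ :=
  Quotient.lift (fun g : 𝒢.Adelic => ((ψ g : ℂˣ) : ℂ)) fun a b hab => by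
    have h : a⁻¹ * b ∈ 𝒢.quotientSubgroup := QuotientGroup.leftRel_apply.mp hab
    have := ψ.map_of_mem h
    rw [map_mul, map_inv, inv_mul_eq_one] at this
    change ((ψ a : ℂˣ) : ℂ) = ((ψ b : ℂˣ) : ℂ)
    rw [this]

/-- `ψ̄ [g] = ψ g` (definitional). [folklore] -/
@[simp] theorem quotientFun_toAutomorphicQuotient (g : 𝒢.Adelic) :
    ψ.quotientFun (𝒢.toAutomorphicQuotient g) = ψ g := rfl

/-- The quotient map `G(𝔸_K) → G(𝔸_K) ⧸ A_G G(K)` is surjective. [folklore] -/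
theorem _root_.Literature.NumberTheory.Automorphic.AdelicGroupData.toAutomorphicQuotient_surjective
    (𝒢 : AdelicGroupData.{u} K) : Function.Surjective 𝒢.toAutomorphicQuotient :=
  Quotient.mk''_surjective

/-- `ψ̄` is continuous on the automorphic quotient. [folklore] -/
theorem continuous_quotientFun : Continuous ψ.quotientFun :=
  continuous_quot_lift _ ψ.continuous

/-- The trivial character descends to the constant function `1`. [folklore] -/
@[simp] theorem quotientFun_one (x : 𝒢.automorphicQuotient) :
    (1 : 𝒢.AutomorphicCharacter).quotientFun x = 1 := by
  obtain ⟨g, rfl⟩ := 𝒢.toAutomorphicQuotient_surjective x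
  rfl

/-- `|ψ̄| = 1`. [folklore] -/
theorem norm_quotientFun (x : 𝒢.automorphicQuotient) : ‖ψ.quotientFun x‖ = 1 := by
  obtain ⟨g, rfl⟩ := 𝒢.toAutomorphicQuotient_surjective x
  exact ψ.norm_coe g

/-- `ψ̄` does not vanish. [folklore] -/
theorem quotientFun_ne_zero (x : 𝒢.automorphicQuotient) : ψ.quotientFun x ≠ 0 := fun h => by
  simpa [h] using ψ.norm_quotientFun x

/-- `ψ̄ (g x) = ψ(g) ψ̄(x)`. [folklore] -/
theorem quotientFun_smul (g : 𝒢.Adelic) (x : 𝒢.automorphicQuotient) :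
    ψ.quotientFun (g • x) = ψ g * ψ.quotientFun x := by
  obtain ⟨y, rfl⟩ := 𝒢.toAutomorphicQuotient_surjective x
  rw [AdelicGroupData.smul_toAutomorphicQuotient, quotientFun_toAutomorphicQuotient,
    quotientFun_toAutomorphicQuotient, map_mul, Units.val_mul]

/-- `ψ⁻¹` descends to `ψ̄⁻¹`. [folklore] -/
@[simp] theorem quotientFun_inv (x : 𝒢.automorphicQuotient) :
    ψ⁻¹.quotientFun x = (ψ.quotientFun x)⁻¹ := by
  obtain ⟨g, rfl⟩ := 𝒢.toAutomorphicQuotient_surjective x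
  rw [quotientFun_toAutomorphicQuotient, quotientFun_toAutomorphicQuotient, coe_inv_apply]

/-- `ψ̄⁻¹ ψ̄ = 1`. [folklore] -/
theorem quotientFun_inv_mul_self (x : 𝒢.automorphicQuotient) :
    ψ⁻¹.quotientFun x * ψ.quotientFun x = 1 := by
  rw [quotientFun_inv, inv_mul_cancel₀ (ψ.quotientFun_ne_zero x)]

/-! ### The multiplication operator `M_ψ` on `L²` -/

section L2

variable (μ : Measure 𝒢.automorphicQuotient)

/-- `ψ̄` is (a.e. strongly) measurable. [folklore] -/
theorem aestronglyMeasurable_quotientFun : AEStronglyMeasurable ψ.quotientFun μ :=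
  ψ.continuous_quotientFun.aestronglyMeasurable

/-- `ψ̄ · f ∈ ℒ²` for `f ∈ L²` (`|ψ̄| = 1`). [folklore] -/
theorem memLp_quotientFun_mul (f : 𝒢.L2 μ) :
    MemLp (fun x => ψ.quotientFun x * f x) 2 μ := by
  refine MemLp.of_le_mul (c := 1) (Lp.memLp f)
    ((ψ.aestronglyMeasurable_quotientFun μ).mul (Lp.aestronglyMeasurable f))
    (Filter.Eventually.of_forall fun x => ?_)
  rw [norm_mul, ψ.norm_quotientFun, one_mul]

/-- The **multiplication operator** `M_ψ : L²(G(𝔸_K) ⧸ A_G G(K)) → L²`, `f ↦ ψ̄ · f`, as a bare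
function (bundled as a linear isometry equivalence in `mulL2Equiv`). [folklore] -/
def mulL2 (f : 𝒢.L2 μ) : 𝒢.L2 μ :=
  (ψ.memLp_quotientFun_mul μ f).toLp _

/-- `M_ψ f = ψ̄ · f` almost everywhere. [folklore] -/
theorem coeFn_mulL2 (f : 𝒢.L2 μ) :
    (ψ.mulL2 μ f : 𝒢.automorphicQuotient → ℂ) =ᵐ[μ] fun x => ψ.quotientFun x * f x :=
  MemLp.coeFn_toLp _

/-- `M_ψ` is additive. [folklore] -/
theorem mulL2_add (f f' : 𝒢.L2 μ) : ψ.mulL2 μ (f + f') = ψ.mulL2 μ f + ψ.mulL2 μ f' := by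
  refine Lp.ext ?_
  filter_upwards [ψ.coeFn_mulL2 μ (f + f'), Lp.coeFn_add (ψ.mulL2 μ f) (ψ.mulL2 μ f'),
    ψ.coeFn_mulL2 μ f, ψ.coeFn_mulL2 μ f', Lp.coeFn_add f f'] with x h1 h2 h3 h4 h5
  rw [h1, h2, Pi.add_apply, h3, h4, h5, Pi.add_apply, mul_add]

/-- `M_ψ` is `ℂ`-homogeneous. [folklore] -/
theorem mulL2_smul (c : ℂ) (f : 𝒢.L2 μ) : ψ.mulL2 μ (c • f) = c • ψ.mulL2 μ f := by
  refine Lp.ext ?_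
  filter_upwards [ψ.coeFn_mulL2 μ (c • f), Lp.coeFn_smul c (ψ.mulL2 μ f), ψ.coeFn_mulL2 μ f,
    Lp.coeFn_smul c f] with x h1 h2 h3 h4
  rw [h1, h2, Pi.smul_apply, h3, h4, Pi.smul_apply, smul_eq_mul, smul_eq_mul, mul_left_comm]

/-- `M_ψ` is isometric (`|ψ̄| = 1`). [folklore] -/
theorem norm_mulL2 (f : 𝒢.L2 μ) : ‖ψ.mulL2 μ f‖ = ‖f‖ := by
  rw [mulL2, Lp.norm_toLp, Lp.norm_def]
  congr 1
  refine eLpNorm_congr_norm_ae (Filter.Eventually.of_forall fun x => ?_)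
  rw [norm_mul, ψ.norm_quotientFun, one_mul]

/-- `M_{ψ⁻¹} M_ψ = 1`. [folklore] -/
theorem mulL2_inv_mulL2 (f : 𝒢.L2 μ) : ψ⁻¹.mulL2 μ (ψ.mulL2 μ f) = f := by
  refine Lp.ext ?_
  filter_upwards [ψ⁻¹.coeFn_mulL2 μ (ψ.mulL2 μ f), ψ.coeFn_mulL2 μ f] with x h1 h2
  rw [h1, h2, ← mul_assoc, quotientFun_inv_mul_self, one_mul]

/-- `M_ψ M_{ψ⁻¹} = 1`. [folklore] -/
theorem mulL2_mulL2_inv (f : 𝒢.L2 μ) : ψ.mulL2 μ (ψ⁻¹.mulL2 μ f) = f := by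
  simpa only [inv_inv] using ψ⁻¹.mulL2_inv_mulL2 μ f

/-- `M_1 = 1`. [folklore] -/
@[simp] theorem mulL2_one (f : 𝒢.L2 μ) : (1 : 𝒢.AutomorphicCharacter).mulL2 μ f = f := by
  refine Lp.ext ?_
  filter_upwards [(1 : 𝒢.AutomorphicCharacter).coeFn_mulL2 μ f] with x hx
  rw [hx, quotientFun_one, one_mul]

/-- `1⁻¹ = 1`. [folklore] -/
theorem inv_one : (1 : 𝒢.AutomorphicCharacter)⁻¹ = 1 :=
  DFunLike.ext _ _ fun g => by simp

/-- The multiplication operator `M_ψ`, `f ↦ ψ̄ · f`, as a **linear isometry equivalence** of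
`L²(G(𝔸_K) ⧸ A_G G(K), μ)` with inverse `M_{ψ⁻¹}` (`|ψ̄| = 1`). [folklore] -/
def mulL2Equiv : 𝒢.L2 μ ≃ₗᵢ[ℂ] 𝒢.L2 μ where
  toFun := ψ.mulL2 μ
  invFun := ψ⁻¹.mulL2 μ
  map_add' := ψ.mulL2_add μ
  map_smul' := ψ.mulL2_smul μ
  left_inv := ψ.mulL2_inv_mulL2 μ
  right_inv := ψ.mulL2_mulL2_inv μ
  norm_map' := ψ.norm_mulL2 μ

/-- Unfolding `mulL2Equiv`. [folklore] -/
@[simp] theorem mulL2Equiv_apply (f : 𝒢.L2 μ) : ψ.mulL2Equiv μ f = ψ.mulL2 μ f := rfl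

/-- The inverse of `mulL2Equiv ψ` is `M_{ψ⁻¹}`. [folklore] -/
@[simp] theorem mulL2Equiv_symm_apply (f : 𝒢.L2 μ) :
    (ψ.mulL2Equiv μ).symm f = ψ⁻¹.mulL2 μ f := rfl

variable [SMulInvariantMeasure 𝒢.Adelic 𝒢.automorphicQuotient μ]

/-- **`M_ψ` intertwines the regular representation with its twist by `ψ⁻¹`:**
`R(g) (ψ̄ f) = ψ(g)⁻¹ ψ̄ (R(g) f)`, since `(R(g) φ)(x) = φ(g⁻¹ x)` and
`ψ̄(g⁻¹ x) = ψ(g)⁻¹ ψ̄(x)`. [folklore] -/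
theorem rightRegular_mulL2 (g : 𝒢.Adelic) (f : 𝒢.L2 μ) :
    𝒢.rightRegular μ g (ψ.mulL2 μ f) =
      ((ψ g : ℂˣ) : ℂ)⁻¹ • ψ.mulL2 μ (𝒢.rightRegular μ g f) := by
  refine Lp.ext ?_
  have h1 := 𝒢.rightRegular_apply_coeFn μ g (ψ.mulL2 μ f)
  have h2 : (fun x => (ψ.mulL2 μ f : 𝒢.automorphicQuotient → ℂ) (g⁻¹ • x)) =ᵐ[μ]
      fun x => ψ.quotientFun (g⁻¹ • x) * f (g⁻¹ • x) :=
    (measurePreserving_smul g⁻¹ μ).quasiMeasurePreserving.ae_eq_comp (ψ.coeFn_mulL2 μ f)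
  have h3 := Lp.coeFn_smul (((ψ g : ℂˣ) : ℂ)⁻¹) (ψ.mulL2 μ (𝒢.rightRegular μ g f))
  have h4 := ψ.coeFn_mulL2 μ (𝒢.rightRegular μ g f)
  have h5 := 𝒢.rightRegular_apply_coeFn μ g f
  filter_upwards [h1, h2, h3, h4, h5] with x h1 h2 h3 h4 h5
  rw [h1, h2, h3, Pi.smul_apply, h4, h5, smul_eq_mul, quotientFun_smul, map_inv,
    Units.val_inv_eq_inv_val, mul_assoc]

/-- Symmetric form: `ψ̄ · R(g) f = ψ(g) R(g) (ψ̄ f)`. [folklore] -/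
theorem mulL2_rightRegular (g : 𝒢.Adelic) (f : 𝒢.L2 μ) :
    ψ.mulL2 μ (𝒢.rightRegular μ g f) = ((ψ g : ℂˣ) : ℂ) • 𝒢.rightRegular μ g (ψ.mulL2 μ f) := by
  rw [rightRegular_mulL2, smul_smul, mul_inv_cancel₀ (Units.ne_zero _), one_smul]

end L2

/-! ### Twisting closed subrepresentations of `L²` by automorphic characters -/

section Twist

variable (μ : Measure 𝒢.automorphicQuotient)
  [SMulInvariantMeasure 𝒢.Adelic 𝒢.automorphicQuotient μ]

/-- `M_ψ` is `ψ`-twisted equivariant for the regular representation: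
`M_ψ (R(g) f) = ψ(g) R(g) (M_ψ f)` (`mulL2_rightRegular`). [folklore] -/
theorem isTwistedEquivariant_mulL2Equiv :
    ContRepresentation.ClosedSubrep.IsTwistedEquivariant (𝒢.rightRegular μ) (𝒢.rightRegular μ)
      (ψ.mulL2Equiv μ).toContinuousLinearEquiv (fun g => ψ g) :=
  fun g f => ψ.mulL2_rightRegular μ g f

end Twist

end AutomorphicCharacter

end AdelicGroupData

end Literature.NumberTheory.Automorphic

namespace ContRepresentation.ClosedSubrep

open Literature.NumberTheory.Automorphic Literature.NumberTheory.Automorphic.AdelicGroupData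

universe u

variable {K : Type} [Field K] [NumberField K] {𝒢 : AdelicGroupData.{u} K}
  {μ : Measure 𝒢.automorphicQuotient} [SMulInvariantMeasure 𝒢.Adelic 𝒢.automorphicQuotient μ]

/-- The **twist** `M_ψ(W) = {ψ̄ f : f ∈ W}` of a closed
subrepresentation `W ≤ L²(G(𝔸_K) ⧸ A_G G(K))` by a unitary automorphic character `ψ` of `G(𝔸_K)`:
again a closed subrepresentation (`mapTwisted` along `M_ψ`). As a representation it is
`W ⊗ ψ⁻¹` in the convention `(R(g)φ)(x) = φ(g⁻¹ x)` of `rightRegular`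
(`rightRegular_mulL2`). Deliberate dot-notation extension of `ContRepresentation.ClosedSubrep`.
[cite: ArthurClozelAMS120, Ch. 3, Thm. 3.1 (p. 172) and Thm. 4.2 (b), (d), (e) (p. 173)] -/
def twist (W : ClosedSubrep (𝒢.rightRegular μ)) (ψ : 𝒢.AutomorphicCharacter) :
    ClosedSubrep (𝒢.rightRegular μ) :=
  W.mapTwisted (ψ.isTwistedEquivariant_mulL2Equiv μ)

variable (W : ClosedSubrep (𝒢.rightRegular μ)) (ψ : 𝒢.AutomorphicCharacter)

/-- `f ∈ M_ψ(W) ↔ ψ̄⁻¹ f ∈ W`. [folklore] -/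
theorem mem_twist_iff {f : 𝒢.L2 μ} : f ∈ W.twist ψ ↔ ψ⁻¹.mulL2 μ f ∈ W :=
  W.mem_mapTwisted_iff _

/-- `ψ̄ f ∈ M_ψ(W)` for `f ∈ W`. [folklore] -/
theorem mulL2_mem_twist {f : 𝒢.L2 μ} (hf : f ∈ W) : ψ.mulL2 μ f ∈ W.twist ψ :=
  W.apply_mem_mapTwisted _ hf

/-- `ψ̄ f ∈ M_ψ(W) ↔ f ∈ W`. [folklore] -/
theorem mulL2_mem_twist_iff {f : 𝒢.L2 μ} : ψ.mulL2 μ f ∈ W.twist ψ ↔ f ∈ W := by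
  rw [mem_twist_iff, ψ.mulL2_inv_mulL2 μ f]

/-- `M_{ψ⁻¹}(M_ψ(W)) = W`. [folklore] -/
@[simp]
theorem twist_twist_inv : (W.twist ψ).twist ψ⁻¹ = W := by
  ext f
  rw [mem_twist_iff, AutomorphicCharacter.inv_inv, mulL2_mem_twist_iff]

/-- `M_ψ(M_{ψ⁻¹}(W)) = W`. [folklore] -/
@[simp]
theorem twist_inv_twist : (W.twist ψ⁻¹).twist ψ = W := by
  simpa only [AutomorphicCharacter.inv_inv] using W.twist_twist_inv ψ⁻¹

omit W in
/-- `M_ψ(W₁) ≤ M_ψ(W₂) ↔ W₁ ≤ W₂`. [folklore] -/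
theorem twist_le_twist_iff {W₁ W₂ : ClosedSubrep (𝒢.rightRegular μ)} :
    W₁.twist ψ ≤ W₂.twist ψ ↔ W₁ ≤ W₂ :=
  mapTwisted_le_mapTwisted_iff (W₁ := W₁) (W₂ := W₂) _

omit W in
/-- `W ↦ M_ψ(W)` is injective. [folklore] -/
theorem twist_injective :
    Function.Injective fun W : ClosedSubrep (𝒢.rightRegular μ) => W.twist ψ :=
  fun _ _ h => le_antisymm ((twist_le_twist_iff ψ).mp h.le) ((twist_le_twist_iff ψ).mp h.ge)

/-- `M_ψ(0) = 0`. [folklore] -/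
@[simp]
theorem twist_bot : (⊥ : ClosedSubrep (𝒢.rightRegular μ)).twist ψ = ⊥ := by
  ext f
  rw [mem_twist_iff, mem_bot, mem_bot]
  constructor
  · intro h
    rw [← ψ.mulL2_mulL2_inv μ f, h]
    exact (ψ.mulL2Equiv μ).map_zero
  · rintro rfl
    exact (ψ⁻¹.mulL2Equiv μ).map_zero

/-- Twisting by the trivial character does nothing. [folklore] -/
@[simp]
theorem twist_one : W.twist 1 = W := by
  ext f
  rw [mem_twist_iff, AutomorphicCharacter.inv_one, AutomorphicCharacter.mulL2_one]

/-- The restriction `W ≃L M_ψ(W)` of the multiplication operator `M_ψ`. [folklore] -/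
def twistEquiv : W.toSubmodule ≃L[ℂ] (W.twist ψ).toSubmodule :=
  (ψ.mulL2Equiv μ).toContinuousLinearEquiv.ofSubmodules _ _ rfl

/-- `twistEquiv` is `M_ψ` on vectors (definitional). [folklore] -/
@[simp]
theorem coe_twistEquiv_apply (f : W.toSubmodule) : (W.twistEquiv ψ f : 𝒢.L2 μ) = ψ.mulL2 μ f :=
  rfl

/-- `W ≃L M_ψ(W)` is `ψ`-twisted equivariant for the restricted regular representations. [folklore] -/
theorem isTwistedEquivariant_twistEquiv :
    IsTwistedEquivariant W.toContRep (W.twist ψ).toContRep (W.twistEquiv ψ) fun g => ψ g := by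
  intro g f
  refine Subtype.ext ?_
  rw [coe_twistEquiv_apply, coe_toContRep_apply, Submodule.coe_smul, coe_toContRep_apply,
    coe_twistEquiv_apply]
  exact ψ.mulL2_rightRegular μ g f

/-- **Twisting preserves topological irreducibility**: `M_ψ(W)` is irreducible iff `W` is
(closed invariant subspaces correspond under `M_ψ`). [folklore] -/
theorem isTopIrreducible_twist_iff :
    (W.twist ψ).toContRep.IsTopIrreducible ↔ W.toContRep.IsTopIrreducible :=
  (isTopIrreducible_iff_of_isTwistedEquivariant (W.isTwistedEquivariant_twistEquiv ψ)).symm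

end ContRepresentation.ClosedSubrep

/-! ### `GL_n`: twisting preserves cuspidality -/

namespace Literature.NumberTheory.Automorphic

open AdelicGroupData

section Cuspidal

variable {n : ℕ} {K : Type} [Field K] [NumberField K]

/-- Vanishing of constant terms is preserved under multiplication by an automorphic character
`ψ` of `GL_n(𝔸_K)` which is trivial on the unipotent radical `N_k(𝔸_K)`: the integrand over
`N_k(K) \ N_k(𝔸_K)` is multiplied by the constant `ψ(x)`. [folklore] -/
theorem ConstantTermVanishes.quotientFun_mul {φ : (gl n K).automorphicQuotient → ℂ} {k : ℕ}
    (hφ : ConstantTermVanishes n K φ k) (ψ : (gl n K).AutomorphicCharacter)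
    (hψ : ∀ X, ψ (glUnipotent n k K X) = 1) :
    ConstantTermVanishes n K (fun x => ψ.quotientFun x * φ x) k := by
  intro ν _ 𝓕 h𝓕 x
  obtain ⟨hφi, hφ0⟩ := hφ ν 𝓕 h𝓕 x
  have key : (fun X : blockNilpotent n k (AdeleRing (𝓞 K) K) =>
      ψ.quotientFun ((gl n K).toAutomorphicQuotient (x * glUnipotent n k K (Multiplicative.ofAdd X))) *
        φ ((gl n K).toAutomorphicQuotient (x * glUnipotent n k K (Multiplicative.ofAdd X)))) =
      fun X => ((ψ x : ℂˣ) : ℂ) *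
        φ ((gl n K).toAutomorphicQuotient (x * glUnipotent n k K (Multiplicative.ofAdd X))) := by
    funext X
    rw [AutomorphicCharacter.quotientFun_toAutomorphicQuotient, map_mul, hψ, mul_one]
  refine ⟨?_, ?_⟩
  · change IntegrableOn (fun X : blockNilpotent n k (AdeleRing (𝓞 K) K) =>
      ψ.quotientFun ((gl n K).toAutomorphicQuotient (x * glUnipotent n k K (Multiplicative.ofAdd X))) *
        φ ((gl n K).toAutomorphicQuotient (x * glUnipotent n k K (Multiplicative.ofAdd X)))) 𝓕 ν
    rw [key]
    exact hφi.const_mul _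
  · change ∫ X in 𝓕, ψ.quotientFun ((gl n K).toAutomorphicQuotient
        (x * glUnipotent n k K (Multiplicative.ofAdd X))) *
      φ ((gl n K).toAutomorphicQuotient (x * glUnipotent n k K (Multiplicative.ofAdd X))) ∂ν = 0
    simp_rw [AutomorphicCharacter.quotientFun_toAutomorphicQuotient, map_mul, hψ, mul_one]
    rw [integral_const_mul, hφ0, mul_zero]

variable {μ : Measure (gl n K).automorphicQuotient}

/-- Continuous square-integrable cusp forms are stable under multiplication by an automorphic
character trivial on the unipotent radicals `N_k(𝔸_K)`, `0 < k < n`. [folklore] -/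
theorem quotientFun_mul_mem_cuspForms {φ : (gl n K).automorphicQuotient → ℂ}
    (hφ : φ ∈ cuspForms n K μ) (ψ : (gl n K).AutomorphicCharacter)
    (hψ : ∀ k, 0 < k → k < n → ∀ X, ψ (glUnipotent n k K X) = 1) :
    (fun x => ψ.quotientFun x * φ x) ∈ cuspForms n K μ := by
  refine ⟨ψ.continuous_quotientFun.mul hφ.1, ?_, fun k hk hkn =>
    (hφ.2.2 k hk hkn).quotientFun_mul ψ (hψ k hk hkn)⟩
  refine MemLp.of_le_mul (c := 1) hφ.2.1
    ((ψ.aestronglyMeasurable_quotientFun μ).mul hφ.2.1.1) (Filter.Eventually.of_forall fun x => ?_)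
  rw [norm_mul, ψ.norm_quotientFun, one_mul]

/-- `M_ψ [φ] = [ψ̄ φ]` for a continuous cusp form `φ`. [folklore] -/
theorem mulL2_cuspFormsToLp (φ : cuspForms n K μ) (ψ : (gl n K).AutomorphicCharacter)
    (hψ : ∀ k, 0 < k → k < n → ∀ X, ψ (glUnipotent n k K X) = 1) :
    ψ.mulL2 μ (cuspFormsToLp n K μ φ) =
      cuspFormsToLp n K μ ⟨_, quotientFun_mul_mem_cuspForms φ.2 ψ hψ⟩ := by
  rw [cuspFormsToLp_apply, cuspFormsToLp_apply]
  refine Lp.ext ?_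
  filter_upwards [ψ.coeFn_mulL2 μ ((memLp_of_mem_cuspForms φ.2).toLp _),
    MemLp.coeFn_toLp (memLp_of_mem_cuspForms φ.2),
    MemLp.coeFn_toLp (memLp_of_mem_cuspForms (quotientFun_mul_mem_cuspForms φ.2 ψ hψ))]
    with x h1 h2 h3
  rw [h1, h2, h3]

/-- `M_ψ` maps classes of continuous cusp forms to classes of continuous cusp forms. [folklore] -/
theorem mulL2_mem_range_cuspFormsToLp {f : (gl n K).L2 μ}
    (hf : f ∈ LinearMap.range (cuspFormsToLp n K μ)) (ψ : (gl n K).AutomorphicCharacter)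
    (hψ : ∀ k, 0 < k → k < n → ∀ X, ψ (glUnipotent n k K X) = 1) :
    ψ.mulL2 μ f ∈ LinearMap.range (cuspFormsToLp n K μ) := by
  obtain ⟨φ, rfl⟩ := hf
  exact ⟨_, (mulL2_cuspFormsToLp φ ψ hψ).symm⟩

variable [SMulInvariantMeasure (gl n K).Adelic (gl n K).automorphicQuotient μ]

/-- `M_ψ` preserves the cuspidal subspace `L²_cusp` (closure of the continuous cusp forms),
for `ψ` trivial on the unipotent radicals. [folklore] -/
theorem mulL2_mem_cuspidalSubspace {f : (gl n K).L2 μ} (hf : f ∈ cuspidalSubspace n K μ)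
    (ψ : (gl n K).AutomorphicCharacter)
    (hψ : ∀ k, 0 < k → k < n → ∀ X, ψ (glUnipotent n k K X) = 1) :
    ψ.mulL2 μ f ∈ cuspidalSubspace n K μ := by
  have hmaps : Set.MapsTo (ψ.mulL2 μ)
      (LinearMap.range (cuspFormsToLp n K μ) : Set ((gl n K).L2 μ))
      (LinearMap.range (cuspFormsToLp n K μ) : Set ((gl n K).L2 μ)) :=
    fun f hf => mulL2_mem_range_cuspFormsToLp hf ψ hψ
  have hcl := hmaps.closure (ψ.mulL2Equiv μ).continuous
  rw [← Submodule.topologicalClosure_coe] at hcl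
  exact hcl hf

/-- **Twists of cuspidal subrepresentations are cuspidal**: `M_ψ(W) ≤ L²_cusp` if `W ≤ L²_cusp`
(for `ψ` trivial on the unipotent radicals). [folklore] -/
theorem twist_le_cuspidalSubspace {W : ContRepresentation.ClosedSubrep ((gl n K).rightRegular μ)}
    (hW : W ≤ cuspidalSubspace n K μ) (ψ : (gl n K).AutomorphicCharacter)
    (hψ : ∀ k, 0 < k → k < n → ∀ X, ψ (glUnipotent n k K X) = 1) :
    W.twist ψ ≤ cuspidalSubspace n K μ := by
  intro f hf
  rw [ContRepresentation.ClosedSubrep.mem_twist_iff] at hf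
  rw [← ψ.mulL2_mulL2_inv μ f]
  exact mulL2_mem_cuspidalSubspace (hW hf) ψ hψ

/-- **The twist `π ⊗ ψ⁻¹` of a cuspidal automorphic representation `π` of `GL_n(𝔸_K)` by a
unitary automorphic character `ψ` trivial on the unipotent radicals** (e.g. `ψ = χ ∘ det`):
the closed irreducible subspace `M_ψ(π) = {ψ̄ f : f ∈ π}` of `L²_cusp`.
[cite: ArthurClozelAMS120, Ch. 3, Thm. 3.1 (p. 172) and Thm. 4.2 (b), (d), (e) (p. 173)] -/
def CuspidalAutomorphicRepGL.twist (P : CuspidalAutomorphicRepGL n K μ)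
    (ψ : (gl n K).AutomorphicCharacter)
    (hψ : ∀ k, 0 < k → k < n → ∀ X, ψ (glUnipotent n k K X) = 1) :
    CuspidalAutomorphicRepGL n K μ :=
  ⟨P.1.twist ψ, twist_le_cuspidalSubspace P.2.1 ψ hψ,
    (ContRepresentation.ClosedSubrep.isTopIrreducible_twist_iff _ _).mpr P.2.2⟩

/-- The closed subrepresentation underlying `P.twist ψ` is `M_ψ(P)` (definitional). [folklore] -/
@[simp]
theorem CuspidalAutomorphicRepGL.twist_val (P : CuspidalAutomorphicRepGL n K μ)
    (ψ : (gl n K).AutomorphicCharacter)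
    (hψ : ∀ k, 0 < k → k < n → ∀ X, ψ (glUnipotent n k K X) = 1) :
    (P.twist ψ hψ).1 = P.1.twist ψ := rfl

end Cuspidal

end Literature.NumberTheory.Automorphic

/-! ### `GL_n`: the automorphic characters `χ ∘ det` and the twists `π ⊗ χ` -/

namespace Literature.NumberTheory.Automorphic

open AdelicGroupData

section DetChar

variable (n : ℕ) {K : Type} [Field K] [NumberField K]

/-- `det` of the diagonal image of `γ ∈ GL_n(K)` is the principal idele `det γ`. [folklore] -/
theorem GLn.det_toAdelic_mem_principalIdeles (γ : GL (Fin n) K) :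
    Matrix.GeneralLinearGroup.det ((gl n K).toAdelic γ) ∈ Literature.NumberTheory.GaloisRepresentations.principalIdeles K := by
  refine ⟨Matrix.GeneralLinearGroup.det γ, Units.ext ?_⟩
  change algebraMap K (AdeleRing (𝓞 K) K) ((γ : Matrix (Fin n) (Fin n) K).det) =
    ((algebraMap K (AdeleRing (𝓞 K) K)).mapMatrix (γ : Matrix (Fin n) (Fin n) K)).det
  rw [RingHom.map_det]

/-- `det (t · 1_n) = t^n` for the positive real scalars `A_G`. [folklore] -/
theorem GLn.det_posRealScalar (t : NNRealˣ) :
    Matrix.GeneralLinearGroup.det (posRealScalar n K t) = posRealIdele K t ^ n := by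
  change Matrix.GeneralLinearGroup.det (Matrix.GeneralLinearGroup.scalar (Fin n) (posRealIdele K t)) = _
  rw [Matrix.GeneralLinearGroup.det_scalar, Fintype.card_fin]

/-- `det (1 + X) = 1` for block-nilpotent `X` (`1 + X` is unipotent upper triangular). [folklore] -/
theorem det_unipotentOfBlock {R : Type*} [CommRing R] {k : ℕ}
    (X : Multiplicative (blockNilpotent n k R)) :
    Matrix.GeneralLinearGroup.det (unipotentOfBlock n k R X) = 1 := by
  refine Units.ext ?_
  change (1 + (X.toAdd : Matrix (Fin n) (Fin n) R)).det = 1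
  have hX := X.toAdd.2
  have htri : (1 + (X.toAdd : Matrix (Fin n) (Fin n) R)).BlockTriangular id := by
    intro i j hij
    have hij' : j < i := hij
    rw [Matrix.add_apply, Matrix.one_apply_ne (ne_of_gt hij'), zero_add]
    exact apply_eq_zero_of_mem_blockNilpotent hX fun h =>
      lt_asymm (lt_of_lt_of_le h.1 h.2) (Fin.lt_def.mp hij')
  rw [Matrix.det_of_upperTriangular htri]
  refine Finset.prod_eq_one fun i _ => ?_
  rw [Matrix.add_apply, Matrix.one_apply_eq,
    apply_eq_zero_of_mem_blockNilpotent hX fun h => lt_irrefl _ (lt_of_lt_of_le h.1 h.2), add_zero]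

/-- `det` of the adelic unipotent element `1 + X`, `X ∈ 𝔫_k(𝔸_K)`, is `1`. [folklore] -/
theorem GLn.det_glUnipotent {k : ℕ}
    (X : Multiplicative (blockNilpotent n k (AdeleRing (𝓞 K) K))) :
    Matrix.GeneralLinearGroup.det (glUnipotent n k K X) = 1 :=
  det_unipotentOfBlock n X

variable {n}

/-- **The automorphic character `χ ∘ det` of `GL_n(𝔸_K)`** attached to a unitary Hecke character
`χ` of `K` (a continuous character of `𝔸_Kˣ / Kˣ`) which is trivial on the positive reals
`ℝ_{>0} ↪ 𝔸_Kˣ` (automatic for `χ` of finite order, `HeckeCharacter.map_posRealIdele_of_isFiniteOrder`):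
it is trivial on `GL_n(K)` (`det γ ∈ Kˣ`) and on `A_G` (`det (t·1) = t^n`).
[cite: ArthurClozelAMS120, Ch. 3, Thm. 3.1 (p. 172) and Thm. 4.2 (b), (d), (e) (p. 173)] -/
def detChar (χ : Literature.NumberTheory.GaloisRepresentations.HeckeCharacter K) (hχ : χ.IsUnitary)
    (hχ₀ : ∀ t, χ (posRealIdele K t) = 1) : (gl n K).AutomorphicCharacter where
  toMonoidHom := χ.toContinuousMonoidHom.toMonoidHom.comp Matrix.GeneralLinearGroup.det
  continuous_coe := Units.continuous_val.comp
    (χ.toContinuousMonoidHom.continuous.comp Matrix.GeneralLinearGroup.continuous_det)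
  norm_apply g := hχ _
  map_eq_one_of_mem := by
    suffices h : (gl n K).quotientSubgroup ≤
        MonoidHom.ker (M := ℂˣ) (χ.toContinuousMonoidHom.toMonoidHom.comp
          (Matrix.GeneralLinearGroup.det :
            GL (Fin n) (AdeleRing (𝓞 K) K) →* (AdeleRing (𝓞 K) K)ˣ)) from
      fun g hg => h hg
    refine sup_le ?_ ?_
    · rintro _ ⟨t, rfl⟩
      change χ (Matrix.GeneralLinearGroup.det (posRealScalar n K t)) = 1
      rw [GLn.det_posRealScalar, map_pow, hχ₀, one_pow]
    · rintro _ ⟨γ, rfl⟩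
      exact χ.map_principal (GLn.det_toAdelic_mem_principalIdeles n γ)

/-- `detChar χ g = χ (det g)` (definitional). [folklore] -/
@[simp]
theorem detChar_apply (χ : Literature.NumberTheory.GaloisRepresentations.HeckeCharacter K) (hχ : χ.IsUnitary)
    (hχ₀ : ∀ t, χ (posRealIdele K t) = 1) (g : GL (Fin n) (AdeleRing (𝓞 K) K)) :
    detChar χ hχ hχ₀ g = χ (Matrix.GeneralLinearGroup.det g) := rfl

/-- `χ ∘ det` is trivial on the unipotent radicals `N_k(𝔸_K)`. [folklore] -/
theorem detChar_glUnipotent (χ : Literature.NumberTheory.GaloisRepresentations.HeckeCharacter K) (hχ : χ.IsUnitary)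
    (hχ₀ : ∀ t, χ (posRealIdele K t) = 1) {k : ℕ}
    (X : Multiplicative (blockNilpotent n k (AdeleRing (𝓞 K) K))) :
    detChar (n := n) χ hχ hχ₀ (glUnipotent n k K X) = 1 := by
  rw [detChar_apply, GLn.det_glUnipotent, map_one]

/-- A Hecke character of finite order is trivial on the positive reals `ℝ_{>0} ↪ 𝔸_Kˣ`
(`ℝ_{>0}` is divisible: `t = (t^{1/m})^m`). [folklore] -/
theorem _root_.Literature.NumberTheory.GaloisRepresentations.HeckeCharacter.map_posRealIdele_of_isFiniteOrder {χ : Literature.NumberTheory.GaloisRepresentations.HeckeCharacter K}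
    (h : χ.IsFiniteOrder) (t : NNRealˣ) : χ (posRealIdele K t) = 1 := by
  obtain ⟨m, hm, h1⟩ := h.exists_pow_eq_one
  have ht0 : (t : NNReal) ≠ 0 := t.ne_zero
  set s : NNRealˣ := Units.mk0 ((t : NNReal) ^ ((m : ℝ)⁻¹)) (by
    exact (NNReal.rpow_pos (pos_iff_ne_zero.mpr ht0)).ne') with hs
  have hst : s ^ m = t := by
    refine Units.ext ?_
    rw [Units.val_pow_eq_pow_val, hs, Units.val_mk0, ← NNReal.rpow_natCast,
      ← NNReal.rpow_mul, inv_mul_cancel₀ (Nat.cast_ne_zero.mpr hm.ne'), NNReal.rpow_one]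
  have := congrArg (fun ψ : Literature.NumberTheory.GaloisRepresentations.HeckeCharacter K => ψ (posRealIdele K s)) h1
  simp only [Literature.NumberTheory.GaloisRepresentations.HeckeCharacter.pow_apply, Literature.NumberTheory.GaloisRepresentations.HeckeCharacter.one_apply] at this
  rw [← hst, map_pow, map_pow, this]

variable {μ : Measure (gl n K).automorphicQuotient}
  [SMulInvariantMeasure (gl n K).Adelic (gl n K).automorphicQuotient μ]

/-- **The twist `π ⊗ χ` of a cuspidal automorphic representation `π` of `GL_n(𝔸_K)` by a unitary
Hecke character `χ`** (Arthur–Clozel (1989), Ch. 3, §1 and Thm. 3.1, Thm. 4.2 (b): the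
representations `π ⊗ η` with `η` the class field character of `E/F`). Realised inside the same
`L²_cusp(GL_n(𝔸_K) ⧸ A_G GL_n(K))` as `M_{(χ∘det)⁻¹}(π) = {(χ̄∘det)⁻¹ · f : f ∈ π}`: in the
convention `(R(g)φ)(x) = φ(g⁻¹x)` this subspace realises `π ⊗ (χ ∘ det)` (`rightRegular_mulL2`),
and its Satake parameters are `χ(ϖ_v) t_{π,v}` (file `AutomorphicTwistSatake`).
[cite: ArthurClozelAMS120, Ch. 3, Thm. 3.1 (p. 172) and Thm. 4.2 (b), (d), (e) (p. 173)] -/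
def CuspidalAutomorphicRepGL.twistByChar (P : CuspidalAutomorphicRepGL n K μ)
    (χ : Literature.NumberTheory.GaloisRepresentations.HeckeCharacter K) (hχ : χ.IsUnitary) (hχ₀ : ∀ t, χ (posRealIdele K t) = 1) :
    CuspidalAutomorphicRepGL n K μ :=
  P.twist (detChar χ hχ hχ₀)⁻¹ fun k _ _ X => by
    rw [AutomorphicCharacter.inv_apply, detChar_glUnipotent, inv_one]

/-- The closed subrepresentation underlying `π ⊗ χ` is `M_{(χ∘det)⁻¹}(π)` (definitional). [folklore] -/
@[simp]
theorem CuspidalAutomorphicRepGL.twistByChar_val (P : CuspidalAutomorphicRepGL n K μ)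
    (χ : Literature.NumberTheory.GaloisRepresentations.HeckeCharacter K) (hχ : χ.IsUnitary) (hχ₀ : ∀ t, χ (posRealIdele K t) = 1) :
    (P.twistByChar χ hχ hχ₀).1 = P.1.twist (detChar χ hχ hχ₀)⁻¹ := rfl

/-- `detChar` of the trivial Hecke character is the trivial automorphic character. [folklore] -/
theorem detChar_one (h₁ : (1 : Literature.NumberTheory.GaloisRepresentations.HeckeCharacter K).IsUnitary)
    (h₂ : ∀ t, (1 : Literature.NumberTheory.GaloisRepresentations.HeckeCharacter K) (posRealIdele K t) = 1) :
    detChar (n := n) 1 h₁ h₂ = 1 :=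
  DFunLike.ext _ _ fun _ => rfl

/-- **Sanity check / non-vacuity: `π ⊗ 1 = π`.** [folklore] -/
theorem CuspidalAutomorphicRepGL.twistByChar_one (P : CuspidalAutomorphicRepGL n K μ)
    (h₁ : (1 : Literature.NumberTheory.GaloisRepresentations.HeckeCharacter K).IsUnitary)
    (h₂ : ∀ t, (1 : Literature.NumberTheory.GaloisRepresentations.HeckeCharacter K) (posRealIdele K t) = 1) :
    P.twistByChar 1 h₁ h₂ = P := by
  refine Subtype.ext ?_
  rw [CuspidalAutomorphicRepGL.twistByChar_val, detChar_one, AutomorphicCharacter.inv_one,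
    ContRepresentation.ClosedSubrep.twist_one]

/-- The trivial Hecke character is unitary and trivial on `ℝ_{>0}`, so `π ⊗ 1` is defined (and
equals `π`, `twistByChar_one`). [folklore] -/
example (P : CuspidalAutomorphicRepGL n K μ) : CuspidalAutomorphicRepGL n K μ :=
  P.twistByChar 1 (fun x => by simp) fun t => rfl

end DetChar

end Literature.NumberTheory.Automorphic
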